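import Mathlib.Combinatorics.SimpleGraph.Connectivity.Subgraph
import Mathlib.Combinatorics.SimpleGraph.Paths
import HarnessLib

/-!
# Walk surgery for minor models: bridges, splits, and the branch-set form of "no `K₄` / no `W₄` minor"

builds on p205010 (kernel theorem, internal audit signed; external expert review pending)

PAPER-2 track "percolation constants", part (ii), seat `prim-consts-1`, gen 23 (lane index
`run/shared/lean/prim/consts/CONSTANTS.md`, row A19; memo `FROM-prim-consts-1-g23-SERIES-PARALLEL.md`).
Support file for the crux `NoHeavyLowerTail` (stmt-CriticalPhenomena-4575; `--supports`).  Theorems only (pure graph theory,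
`SimpleGraph.Walk`); no definitions, no sorries.  Used by `…ConstsClusterSquareW4Minor.lean`: a cross-linkage at a connected
vertex set (gen 22, `Consts.not_quadClash_of_unlinked₄`) is a `W₄` minor.

Contents: `Consts.Minor.exists_bridge` (a walk from `S` to `T` contains a sub-path meeting `S` only at its start and `T` only at
its end), `Consts.Minor.takeUntil_dropUntil_disjoint` (the two halves of a path split at a vertex meet only there),
`Consts.Minor.exists_split` (a path through `p ≠ s` splits into two disjoint connected vertex sets `PP ∋ p`, `SS ∋ s` joined by an
edge at `s`, the two ends in different parts), connectivity of walk supports and of closure-connected sets as INDUCED subgraphs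
(`Consts.Minor.induce_connected_of_closure`, `…_union`), and `Consts.Minor.noW4Minor_of_noK4Minor` (merging two rim branch
sets).  MINORS IN BRANCH-SET FORM: "`H` has a `K₄` minor" = four pairwise disjoint vertex sets, each inducing a connected
subgraph, pairwise joined by `H`-edges; "`H` has a `W₄` minor" = a hub set and four rim sets, pairwise disjoint, each inducing a
connected subgraph, the hub joined to every rim set and the rim sets joined cyclically.
References: R. Diestel, Graph Theory (5th ed.), §1.7 (minors as branch sets); R. J. Duffin, J. Math. Anal. Appl. 10 (1965)
303–318 (series-parallel ⟺ no `K₄` subdivision).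
-/

namespace Summit.CriticalPhenomena.PercolationContinuityZ3.Theorems

namespace Consts

namespace Minor

variable {V : Type*} {H : SimpleGraph V}

/-- A walk between distinct vertices starts with an edge. [folklore] -/
theorem exists_cons {u v : V} (W : H.Walk u v) (h : u ≠ v) :
    ∃ (x : V) (_ : H.Adj u x) (W' : H.Walk x v), W.support = u :: W'.support := by
  cases W with
  | nil => exact absurd rfl h
  | cons hux W' => exact ⟨_, hux, W', rfl⟩

/-- A set that is `H`-connected from `a` in closure form (every set containing `a` and closed under `H`-steps into `K`
contains `K`) induces a connected subgraph. [folklore] -/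
theorem induce_connected_of_closure {K : Set V} {a : V} (haK : a ∈ K)
    (hcl : ∀ T : Set V, a ∈ T → (∀ u x, u ∈ T → H.Adj u x → x ∈ K → x ∈ T) → K ⊆ T) :
    (H.induce K).Connected := by
  have hKw : ∀ s ∈ K, ∃ W : H.Walk a s, ∀ v ∈ W.support, v ∈ K := by
    intro s hs
    refine hcl {v | ∃ W : H.Walk a v, ∀ z ∈ W.support, z ∈ K} ⟨SimpleGraph.Walk.nil, ?_⟩ ?_ hs
    · intro z hz
      rw [SimpleGraph.Walk.support_nil, List.mem_singleton] at hz
      exact hz ▸ haK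
    · rintro u x ⟨W, hW⟩ hux hxK
      refine ⟨W.concat hux, fun z hz => ?_⟩
      rw [SimpleGraph.Walk.support_concat, List.mem_append, List.mem_singleton] at hz
      rcases hz with hz | rfl
      · exact hW z hz
      · exact hxK
  refine SimpleGraph.induce_connected_of_patches a haK fun {v} hv => ?_
  obtain ⟨W, hW⟩ := hKw v hv
  exact ⟨{x | x ∈ W.support}, fun x hx => hW x hx, W.start_mem_support, W.end_mem_support,
    (W.connected_induce_support).preconnected _ _⟩

/-- The union of two walk supports with a common vertex induces a connected subgraph. [folklore] -/
theorem induce_connected_union {u v u' v' : V} (W : H.Walk u v) (W' : H.Walk u' v') (x : V) (hx : x ∈ W.support)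
    (hx' : x ∈ W'.support) : (H.induce ({t | t ∈ W.support} ∪ {t | t ∈ W'.support})).Connected :=
  SimpleGraph.induce_union_connected (W.connected_induce_support).preconnected (W'.connected_induce_support).preconnected
    ⟨x, hx, hx'⟩

/-- **No `K₄` minor ⟹ no `W₄` minor** (branch-set form): merge two consecutive rim sets of a `W₄` model.
[cite: Diestel2017, §1.7 (minors as branch sets)] -/
theorem noW4Minor_of_noK4Minor
    (hK4 : ∀ B₀ B₁ B₂ B₃ : Set V,
      (H.induce B₀).Connected → (H.induce B₁).Connected → (H.induce B₂).Connected → (H.induce B₃).Connected →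
      Disjoint B₀ B₁ → Disjoint B₀ B₂ → Disjoint B₀ B₃ → Disjoint B₁ B₂ → Disjoint B₁ B₃ → Disjoint B₂ B₃ →
      (∃ u ∈ B₀, ∃ v ∈ B₁, H.Adj u v) → (∃ u ∈ B₀, ∃ v ∈ B₂, H.Adj u v) → (∃ u ∈ B₀, ∃ v ∈ B₃, H.Adj u v) →
      (∃ u ∈ B₁, ∃ v ∈ B₂, H.Adj u v) → (∃ u ∈ B₁, ∃ v ∈ B₃, H.Adj u v) → (∃ u ∈ B₂, ∃ v ∈ B₃, H.Adj u v) → False) :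
    ∀ B₀ A₁ A₂ A₃ A₄ : Set V,
      (H.induce B₀).Connected → (H.induce A₁).Connected → (H.induce A₂).Connected → (H.induce A₃).Connected →
      (H.induce A₄).Connected →
      Disjoint B₀ A₁ → Disjoint B₀ A₂ → Disjoint B₀ A₃ → Disjoint B₀ A₄ →
      Disjoint A₁ A₂ → Disjoint A₁ A₃ → Disjoint A₁ A₄ → Disjoint A₂ A₃ → Disjoint A₂ A₄ → Disjoint A₃ A₄ →
      (∃ u ∈ B₀, ∃ v ∈ A₁, H.Adj u v) → (∃ u ∈ B₀, ∃ v ∈ A₂, H.Adj u v) → (∃ u ∈ B₀, ∃ v ∈ A₃, H.Adj u v) →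
      (∃ u ∈ B₀, ∃ v ∈ A₄, H.Adj u v) →
      (∃ u ∈ A₁, ∃ v ∈ A₂, H.Adj u v) → (∃ u ∈ A₂, ∃ v ∈ A₃, H.Adj u v) → (∃ u ∈ A₃, ∃ v ∈ A₄, H.Adj u v) →
      (∃ u ∈ A₄, ∃ v ∈ A₁, H.Adj u v) → False := by
  intro B₀ A₁ A₂ A₃ A₄ c0 c1 c2 c3 c4 d01 d02 d03 d04 d12 d13 d14 d23 d24 _ a01 a02 a03 _ a12 a23 a34 a41
  obtain ⟨u, hu, v, hv, huv⟩ := a34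
  have c34 : (H.induce (A₃ ∪ A₄)).Connected :=
    SimpleGraph.connected_induce_union c3.preconnected c4.preconnected hu hv huv
  obtain ⟨x, hx, t, ht, hxt⟩ := a03
  obtain ⟨x', hx', t', ht', hxt'⟩ := a23
  obtain ⟨x'', hx'', t'', ht'', hxt''⟩ := a41
  exact hK4 B₀ A₁ A₂ (A₃ ∪ A₄) c0 c1 c2 c34 d01 d02 (Set.disjoint_union_right.mpr ⟨d03, d04⟩) d12
    (Set.disjoint_union_right.mpr ⟨d13, d14⟩) (Set.disjoint_union_right.mpr ⟨d23, d24⟩) a01 a02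
    ⟨x, hx, t, Or.inl ht, hxt⟩ a12 ⟨t'', ht'', x'', Or.inr hx'', hxt''.symm⟩ ⟨x', hx', t', Or.inl ht', hxt'⟩

variable [DecidableEq V]

/-- **Bridge lemma.**  A walk from a vertex of `S` to a vertex of `T` contains a sub-walk `D : r → s` with `r ∈ S`, `s ∈ T`
meeting `S` only at `r` and `T` only at `s` (a path if the walk is one): `s` is the first vertex of the walk in `T`, `r` the last
vertex before it in `S`. [folklore] -/
theorem exists_bridge {u v : V} (W : H.Walk u v) (S T : Finset V) (hu : u ∈ S) (hv : v ∈ T) :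
    ∃ (r s : V) (D : H.Walk r s), r ∈ S ∧ s ∈ T ∧ (∀ x ∈ D.support, x ∈ W.support) ∧
      (∀ x ∈ D.support, x ∈ S → x = r) ∧ (∀ x ∈ D.support, x ∈ T → x = s) ∧ (W.IsPath → D.IsPath) := by
  obtain ⟨s, hsT, hs, hsfirst⟩ := SimpleGraph.Walk.exists_mem_support_forall_mem_support_imp_eq (p := W) T
    ⟨v, Finset.mem_filter.mpr ⟨hv, W.end_mem_support⟩⟩
  set P := W.takeUntil s hs with hP
  obtain ⟨r, hrS, hr, hrfirst⟩ := SimpleGraph.Walk.exists_mem_support_forall_mem_support_imp_eq (p := P.reverse) S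
    ⟨u, Finset.mem_filter.mpr ⟨hu, P.reverse.end_mem_support⟩⟩
  set Q := P.reverse.takeUntil r hr with hQ
  have hQP : ∀ x ∈ Q.support, x ∈ P.support := fun x hx => by
    have h1 := P.reverse.support_takeUntil_subset_support hr hx
    rwa [SimpleGraph.Walk.support_reverse, List.mem_reverse] at h1
  refine ⟨r, s, Q.reverse, hrS, hsT, fun x hx => ?_, fun x hx hxS => ?_, fun x hx hxT => ?_, fun hW => ?_⟩
  · rw [SimpleGraph.Walk.support_reverse, List.mem_reverse] at hx
    exact W.support_takeUntil_subset_support hs (hQP x hx)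
  · rw [SimpleGraph.Walk.support_reverse, List.mem_reverse] at hx
    exact hrfirst x hxS hx
  · rw [SimpleGraph.Walk.support_reverse, List.mem_reverse] at hx
    exact hsfirst x hxT (hQP x hx)
  · exact ((hW.takeUntil hs).reverse.takeUntil hr).reverse

/-- Splitting a path at a vertex: the two pieces meet only there. [folklore] -/
theorem takeUntil_dropUntil_disjoint {u v q : V} (P : H.Walk u v) (hP : P.IsPath) (hq : q ∈ P.support) :
    ∀ x, x ∈ (P.takeUntil q hq).support → x ∈ (P.dropUntil q hq).support → x = q := by
  intro x hx1 hx2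
  by_contra hxq
  have hnd := hP.support_nodup
  rw [← P.take_spec hq, SimpleGraph.Walk.support_append] at hnd
  have h2 : x ∈ (P.dropUntil q hq).support.tail := by
    rw [← SimpleGraph.Walk.cons_tail_support (P.dropUntil q hq), List.mem_cons] at hx2
    exact hx2.resolve_left hxq
  exact (List.disjoint_of_nodup_append hnd) hx1 h2

/-- **Split lemma.**  A path through two distinct vertices `p, s` splits into disjoint vertex sets `PP ∋ p` and `SS ∋ s`, each
inducing a connected subgraph, with an edge from `PP` into `s`, the two ends of the path in different parts (the part of `s` is
the segment from `s` away from `p`). [folklore] -/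
theorem exists_split {u v p s : V} (P : H.Walk u v) (hP : P.IsPath) (hp : p ∈ P.support) (hs : s ∈ P.support)
    (hps : p ≠ s) :
    ∃ PP SS : Set V, (H.induce PP).Connected ∧ (H.induce SS).Connected ∧ Disjoint PP SS ∧ p ∈ PP ∧ s ∈ SS ∧
      (∃ m ∈ PP, H.Adj m s) ∧ (∀ x ∈ PP, x ∈ P.support) ∧ (∀ x ∈ SS, x ∈ P.support) ∧
      ((u ∈ PP ∧ v ∈ SS) ∨ (u ∈ SS ∧ v ∈ PP)) := by
  set Pa := P.takeUntil p hp with hPadef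
  set Pb := P.dropUntil p hp with hPbdef
  have hPa : ∀ x ∈ Pa.support, x ∈ P.support := fun x hx => P.support_takeUntil_subset_support hp hx
  have hPb : ∀ x ∈ Pb.support, x ∈ P.support := fun x hx => P.support_dropUntil_subset_support hp hx
  have hab : ∀ x, x ∈ Pa.support → x ∈ Pb.support → x = p := takeUntil_dropUntil_disjoint P hP hp
  have hPapath : Pa.IsPath := hP.takeUntil hp
  have hPbpath : Pb.IsPath := hP.dropUntil hp
  have hs' : s ∈ Pa.support ∨ s ∈ Pb.support := by
    rw [← P.take_spec hp, SimpleGraph.Walk.mem_support_append_iff] at hs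
    exact hs
  by_cases hsb : s ∈ Pb.support
  · -- order `u, p, s, v`
    set Pb₁ := Pb.takeUntil s hsb with hPb₁def
    set Pb₂ := Pb.dropUntil s hsb with hPb₂def
    have h12 : ∀ x, x ∈ Pb₁.support → x ∈ Pb₂.support → x = s := takeUntil_dropUntil_disjoint Pb hPbpath hsb
    have hPb₁ : ∀ x ∈ Pb₁.support, x ∈ Pb.support := fun x hx => Pb.support_takeUntil_subset_support hsb hx
    have hPb₂ : ∀ x ∈ Pb₂.support, x ∈ Pb.support := fun x hx => Pb.support_dropUntil_subset_support hsb hx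
    obtain ⟨m, hsm, M, hM⟩ := exists_cons Pb₁.reverse hps.symm
    have hMb₁ : ∀ x ∈ M.support, x ∈ Pb₁.support := fun x hx => by
      have h : x ∈ Pb₁.reverse.support := by rw [hM]; exact List.mem_cons_of_mem _ hx
      rwa [SimpleGraph.Walk.support_reverse, List.mem_reverse] at h
    have hsM : s ∉ M.support := by
      intro h
      have hnd := (hPbpath.takeUntil hsb).reverse.support_nodup
      rw [hM, List.nodup_cons] at hnd
      exact hnd.1 h
    refine ⟨{t | t ∈ Pa.support} ∪ {t | t ∈ M.support}, {t | t ∈ Pb₂.support},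
      induce_connected_union Pa M p Pa.end_mem_support M.end_mem_support, Pb₂.connected_induce_support,
      Set.disjoint_left.mpr fun x hx1 hx2 => ?_, Or.inl Pa.end_mem_support, Pb₂.start_mem_support,
      ⟨m, Or.inr M.start_mem_support, hsm.symm⟩, fun x hx => ?_, fun x hx => hPb x (hPb₂ x hx),
      Or.inl ⟨Or.inl Pa.start_mem_support, Pb₂.end_mem_support⟩⟩
    · rcases hx1 with hx | hx
      · have hxp : x = p := hab x hx (hPb₂ x hx2)
        rw [hxp] at hx2
        exact hps (h12 p Pb₁.start_mem_support hx2)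
      · exact hsM ((h12 x (hMb₁ x hx) hx2) ▸ hx)
    · rcases hx with hx | hx
      · exact hPa x hx
      · exact hPb x (hPb₁ x (hMb₁ x hx))
  · -- order `u, s, p, v`
    have hsa : s ∈ Pa.support := hs'.resolve_right hsb
    set Pa₁ := Pa.takeUntil s hsa with hPa₁def
    set Pa₂ := Pa.dropUntil s hsa with hPa₂def
    have h12 : ∀ x, x ∈ Pa₁.support → x ∈ Pa₂.support → x = s := takeUntil_dropUntil_disjoint Pa hPapath hsa
    have hPa₁ : ∀ x ∈ Pa₁.support, x ∈ Pa.support := fun x hx => Pa.support_takeUntil_subset_support hsa hx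
    have hPa₂ : ∀ x ∈ Pa₂.support, x ∈ Pa.support := fun x hx => Pa.support_dropUntil_subset_support hsa hx
    obtain ⟨m, hsm, M, hM⟩ := exists_cons Pa₂ hps.symm
    have hMa₂ : ∀ x ∈ M.support, x ∈ Pa₂.support := fun x hx => by rw [hM]; exact List.mem_cons_of_mem _ hx
    have hsM : s ∉ M.support := by
      intro h
      have hnd := (hPapath.dropUntil hsa).support_nodup
      rw [hM, List.nodup_cons] at hnd
      exact hnd.1 h
    refine ⟨{t | t ∈ M.support} ∪ {t | t ∈ Pb.support}, {t | t ∈ Pa₁.support},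
      induce_connected_union M Pb p M.end_mem_support Pb.start_mem_support, Pa₁.connected_induce_support,
      Set.disjoint_left.mpr fun x hx1 hx2 => ?_, Or.inr Pb.start_mem_support, Pa₁.end_mem_support,
      ⟨m, Or.inl M.start_mem_support, hsm.symm⟩, fun x hx => ?_, fun x hx => hPa x (hPa₁ x hx),
      Or.inr ⟨Pa₁.start_mem_support, Or.inr Pb.end_mem_support⟩⟩
    · rcases hx1 with hx | hx
      · exact hsM ((h12 x hx2 (hMa₂ x hx)) ▸ hx)
      · have hxp : x = p := hab x (hPa₁ x hx2) hx
        rw [hxp] at hx2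
        exact hps (h12 p hx2 Pa₂.end_mem_support)
    · rcases hx with hx | hx
      · exact hPa x (hPa₂ x (hMa₂ x hx))
      · exact hPb x hx

end Minor

end Consts

end Summit.CriticalPhenomena.PercolationContinuityZ3.Theorems
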